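import Literature.AlgebraicGeometry.ModuliOfAbelianVarieties.SiegelShimuraSetDissection
import Literature.AlgebraicGeometry.ModuliOfAbelianVarieties.SiegelComplexRecordSystem
import HarnessLib

/-!
# Level change in the Siegel Shimura set and in its dissection: `[J, aK′] ↦ [J, aK]` for `K′ ≤ K`

Topic `AlgebraicGeometry/ModuliOfAbelianVarieties`; namespace `Literature.AlgebraicGeometry.ModuliOfAbelianVarieties`,
grouping sub-namespace `SiegelShimuraSet`.  Definitions WITH BODIES (three maps) and theorems; no named fact, no instance,
no notation, no `sorry`.  Cell hodgecm-mathlib (D-0151): banked generic leaf toward row #60 `SiegelS1` (#60 road «R60-13c»,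
sequel of ★ R60-13 `SiegelShimuraSetDissection` / ★ R60-13b); books 0.  HC_CM is proved only modulo the 7 printed citations
until rung 0 closes.

Printed statement.  [Deligne1971TravauxShimura] 1.8 p. 129 («pour `K′ ⊂ K`, l'application évidente `M_{K′}(ℂ) → M_K(ℂ)`»; the
tower `(M_K)_K` with its transition maps) and [Milne2005ShimuraVarieties] §5 p. 56 (5.1) with Lemma 5.13 p. 57: the transition map
of the double coset spaces `G(ℚ)∖X × G(𝔸_f)/K′ → G(ℚ)∖X × G(𝔸_f)/K`, `[x, aK′] ↦ [x, aK]`, is well defined, surjective, functorial in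
`K″ ≤ K′ ≤ K`, and compatible with the dissection `⨆ Γ_g∖X` (the index passes to the coarser double coset, the piece of a
representative `g` maps by `Γ′_g∖X → Γ_g∖X`, `Γ′_g = gK′g⁻¹ ∩ G(ℚ) ≤ Γ_g`).  For `G = GSp_δ`, `X = S^±` this is the SET-LEVEL content of the
record field `SiegelComplexRecordSystem.map_pts` (★ `SiegelComplexRecordSystem.lean`), i.e. what an assembled Siegel tower must satisfy
on complex points at the principal levels `K_δ(N′) ≤ K_δ(N)`, `N ∣ N′` (★ `principalLevelSubgroup_anti`).

Contents: §1 `SiegelShimuraSet.restrict h : SiegelShimuraSet δ K′ → SiegelShimuraSet δ K` (`restrict_mk`, surjective, `restrict_self`,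
`restrict_restrict`); §2 the index: `Index.restrict`, `index_restrict`; §3 the pieces: `arithLevel_mono`, `Piece.restrict`,
`restrict_pieceMap` (the dissection square); §4 principal levels.

## References
* [Deligne1971TravauxShimura] P. Deligne, *Travaux de Shimura* (1971), 1.8 p. 129, 4.16 p. 150.
* [Milne2005ShimuraVarieties] J. S. Milne, *Introduction to Shimura varieties* (2005), §5 (5.1) p. 56, Lemma 5.13 p. 57.
-/

set_option autoImplicit false

noncomputable section

open Function MulAction CategoryTheory
open Literature.AlgebraicGeometry.Motives (AlgPoints)

namespace Literature.AlgebraicGeometry.ModuliOfAbelianVarieties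

namespace SiegelShimuraSet

variable {g : ℕ} (δ : Fin g → ℕ) {K K' K'' : Subgroup (gspFinAdelic δ)}

/-! ### §1. The transition map `[J, aK′] ↦ [J, aK]` -/

/-- Equal classes at the finer level stay equal at the coarser level. [cite: Deligne1971TravauxShimura, 1.8 p. 129] -/
theorem mk_eq_mk_of_le (h : K' ≤ K) {J J' : C0pm δ} {a a' : gspFinAdelic δ}
    (he : SiegelShimuraSet.mk δ K' J a = SiegelShimuraSet.mk δ K' J' a') :
    SiegelShimuraSet.mk δ K J a = SiegelShimuraSet.mk δ K J' a' := by
  rw [SiegelShimuraSet.mk_eq_mk_iff] at he ⊢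
  obtain ⟨γ, h1, h2⟩ := he
  refine ⟨γ, h1, ?_⟩
  have h3 : ((gspRationalToFinAdelic δ γ * a' : gspFinAdelic δ) : gspFinAdelic δ ⧸ K') = (a : gspFinAdelic δ ⧸ K') := h2
  show ((gspRationalToFinAdelic δ γ * a' : gspFinAdelic δ) : gspFinAdelic δ ⧸ K) = (a : gspFinAdelic δ ⧸ K)
  exact QuotientGroup.eq.2 (h (QuotientGroup.eq.1 h3))

/-- **The transition map `Sh_{K′} → Sh_K`, `[J, aK′] ↦ [J, aK]`, for `K′ ≤ K`** («l'application évidente»).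
[cite: Deligne1971TravauxShimura, 1.8 p. 129] [cite: Milne2005ShimuraVarieties, §5 (5.1) p. 56] -/
def restrict (h : K' ≤ K) : SiegelShimuraSet δ K' → SiegelShimuraSet δ K :=
  Quotient.lift
    (fun p : C0pm δ × (gspFinAdelic δ ⧸ K') =>
      Quotient.liftOn' p.2 (fun a => SiegelShimuraSet.mk δ K p.1 a) fun a b hab =>
        mk_eq_mk_of_le δ h (J := p.1) (J' := p.1)
          ((SiegelShimuraSet.mk_eq_mk_iff δ K' p.1 p.1 a b).2
            ⟨1, by rw [map_one, conjAct_one], by rw [map_one, one_smul]; exact (Quotient.sound hab).symm⟩))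
    (by
      rintro ⟨J, qa⟩ ⟨J', qa'⟩ hJJ'
      induction qa using QuotientGroup.induction_on with | H a => ?_
      induction qa' using QuotientGroup.induction_on with | H a' => ?_
      exact mk_eq_mk_of_le δ h (Quotient.sound hJJ'))

/-- `restrict h [J, aK′] = [J, aK]`. [cite: Deligne1971TravauxShimura, 1.8 p. 129] -/
@[simp] theorem restrict_mk (h : K' ≤ K) (J : C0pm δ) (a : gspFinAdelic δ) :
    restrict δ h (SiegelShimuraSet.mk δ K' J a) = SiegelShimuraSet.mk δ K J a :=
  rfl

/-- The transition map is surjective. [cite: Deligne1971TravauxShimura, 1.8 p. 129] -/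
theorem restrict_surjective (h : K' ≤ K) : Surjective (restrict δ h) := by
  intro c
  obtain ⟨⟨J, a⟩, rfl⟩ := SiegelShimuraSet.mk_surjective δ K c
  exact ⟨SiegelShimuraSet.mk δ K' J a, rfl⟩

/-- Functoriality: `restrict (le_refl K) = id`. [cite: Deligne1971TravauxShimura, 1.8 p. 129] -/
theorem restrict_self (c : SiegelShimuraSet δ K) : restrict δ (le_refl K) c = c := by
  obtain ⟨⟨J, a⟩, rfl⟩ := SiegelShimuraSet.mk_surjective δ K c
  rfl

/-- Functoriality: `restrict_{K′≤K} ∘ restrict_{K″≤K′} = restrict_{K″≤K}`. [cite: Deligne1971TravauxShimura, 1.8 p. 129] -/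
theorem restrict_restrict (h₁ : K'' ≤ K') (h₂ : K' ≤ K) (c : SiegelShimuraSet δ K'') :
    restrict δ h₂ (restrict δ h₁ c) = restrict δ (h₁.trans h₂) c := by
  obtain ⟨⟨J, a⟩, rfl⟩ := SiegelShimuraSet.mk_surjective δ K'' c
  rfl

/-- The transition map commutes with the `GSp_δ(ℚ)`-moves of representatives: `restrict [γJγ⁻¹, γaK′] = [J, aK]`.
[cite: Milne2005ShimuraVarieties, §5 (5.1) p. 56] -/
theorem restrict_mk_conjAct_smul (h : K' ≤ K) (γ : gspRational δ) (J : C0pm δ) (a : gspFinAdelic δ) :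
    restrict δ h (SiegelShimuraSet.mk δ K' (conjAct δ (gspRationalToReal δ γ) J) (gspRationalToFinAdelic δ γ * a)) =
      SiegelShimuraSet.mk δ K J a := by
  rw [restrict_mk, SiegelShimuraSet.mk_conjAct_smul]

/-! ### §2. Level change on the index `Ξ_K = GSp_δ(ℚ)∖GSp_δ(𝔸_f)/K` -/

/-- Equal indices at the finer level stay equal at the coarser level. [cite: Milne2005ShimuraVarieties, Lemma 5.13 p. 57] -/
theorem indexOf_eq_indexOf_of_le (h : K' ≤ K) {a b : gspFinAdelic δ} (he : indexOf δ K' a = indexOf δ K' b) :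
    indexOf δ K a = indexOf δ K b := by
  rw [indexOf_eq_indexOf_iff] at he ⊢
  obtain ⟨γ, k, hk, hb⟩ := he
  exact ⟨γ, k, h hk, hb⟩

/-- **The index transition `Ξ_{K′} → Ξ_K`, `GSp_δ(ℚ) a K′ ↦ GSp_δ(ℚ) a K`.** [cite: Milne2005ShimuraVarieties, Lemma 5.13 p. 57] -/
def Index.restrict (h : K' ≤ K) : Index δ K' → Index δ K :=
  Quotient.lift (indexOf δ K) fun _ _ hab => indexOf_eq_indexOf_of_le δ h (Quotient.sound hab)

/-- `Index.restrict h (GSp_δ(ℚ) a K′) = GSp_δ(ℚ) a K`. [cite: Milne2005ShimuraVarieties, Lemma 5.13 p. 57] -/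
@[simp] theorem Index.restrict_indexOf (h : K' ≤ K) (a : gspFinAdelic δ) :
    Index.restrict δ h (indexOf δ K' a) = indexOf δ K a :=
  rfl

/-- The index transition is surjective. [cite: Milne2005ShimuraVarieties, Lemma 5.13 p. 57] -/
theorem Index.restrict_surjective (h : K' ≤ K) : Surjective (Index.restrict δ h) := by
  intro q
  obtain ⟨a, rfl⟩ := indexOf_surjective δ K q
  exact ⟨indexOf δ K' a, rfl⟩

/-- **Naturality of the index map**: `index_K ∘ restrict = Index.restrict ∘ index_{K′}` (a point keeps its piece).
[cite: Milne2005ShimuraVarieties, Lemma 5.13 p. 57] -/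
theorem index_restrict (h : K' ≤ K) (c : SiegelShimuraSet δ K') :
    index δ K (restrict δ h c) = Index.restrict δ h (index δ K' c) := by
  obtain ⟨⟨J, a⟩, rfl⟩ := SiegelShimuraSet.mk_surjective δ K' c
  rfl

/-! ### §3. Level change on the pieces: `Γ′_ξ ≤ Γ_ξ` and the dissection square -/

/-- `Γ′_ξ = GSp_δ(ℚ) ∩ ξK′ξ⁻¹ ≤ Γ_ξ = GSp_δ(ℚ) ∩ ξKξ⁻¹` for `K′ ≤ K`. [cite: Milne2005ShimuraVarieties, Lemma 5.13 p. 57] -/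
theorem arithLevel_mono (h : K' ≤ K) (ξ : gspFinAdelic δ) : arithLevel δ K' ξ ≤ arithLevel δ K ξ := fun γ hγ => by
  rw [mem_arithLevel_iff] at hγ ⊢
  exact h hγ

variable {δ} in
/-- **The map of pieces `Δ′∖S^± → Δ∖S^±` for `Δ′ ≤ Δ ≤ GSp_δ(ℚ)`** (identity on representatives).
[cite: Milne2005ShimuraVarieties, Lemma 5.13 p. 57] -/
def Piece.restrict {Δ' Δ : Subgroup (gspRational δ)} (hΔ : Δ' ≤ Δ) : Piece δ Δ' → Piece δ Δ :=
  Quotient.map' id fun J J' (hJJ' : pieceRel δ Δ' J J') => by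
    obtain ⟨γ, hγ⟩ := hJJ'
    exact ⟨⟨(γ : gspRational δ), hΔ γ.2⟩, hγ⟩

/-- `Piece.restrict [J] = [J]`. [cite: Milne2005ShimuraVarieties, Lemma 5.13 p. 57] -/
@[simp] theorem Piece.restrict_mk {Δ' Δ : Subgroup (gspRational δ)} (hΔ : Δ' ≤ Δ) (J : C0pm δ) :
    Piece.restrict hΔ (Piece.mk δ Δ' J) = Piece.mk δ Δ J :=
  rfl

/-- `Piece.restrict` is surjective. [cite: Milne2005ShimuraVarieties, Lemma 5.13 p. 57] -/
theorem Piece.restrict_surjective {Δ' Δ : Subgroup (gspRational δ)} (hΔ : Δ' ≤ Δ) :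
    Surjective (Piece.restrict (δ := δ) hΔ) := by
  intro c
  induction c using Piece.ind with | h J => ?_
  exact ⟨Piece.mk δ Δ' J, rfl⟩

/-- **The dissection square**: for a representative `ξ`, `restrict ∘ pieceMap_{K′} ξ = pieceMap_K ξ ∘ (Γ′_ξ∖S^± → Γ_ξ∖S^±)`
(«`[x] ↦ [x, g]`» at both levels). [cite: Milne2005ShimuraVarieties, Lemma 5.13 p. 57] [cite: Deligne1971TravauxShimura, 1.8 p. 129] -/
theorem restrict_pieceMap (h : K' ≤ K) (ξ : gspFinAdelic δ) (p : Piece δ (arithLevel δ K' ξ)) :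
    restrict δ h (pieceMap δ K' ξ p) = pieceMap δ K ξ (Piece.restrict (arithLevel_mono δ h ξ) p) := by
  induction p using Piece.ind with | h J => ?_
  rfl

/-- The dissection square on `Σ`-types: for ONE family `g′` of representatives of `Ξ_{K′}`, `restrict ∘ sigmaMap g′` factors through
the pieces of `K` at the same representatives (`sigmaMap` read at level `K` on `q ↦ g′ q`).
[cite: Milne2005ShimuraVarieties, Lemma 5.13 p. 57] -/
theorem restrict_sigmaMap (h : K' ≤ K) (g' : Index δ K' → gspFinAdelic δ) (q : Index δ K')
    (p : Piece δ (arithLevel δ K' (g' q))) :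
    restrict δ h (sigmaMap g' ⟨q, p⟩) = pieceMap δ K (g' q) (Piece.restrict (arithLevel_mono δ h (g' q)) p) :=
  restrict_pieceMap δ h (g' q) p

/-- The transition map read through the dissections: for representatives `g′` of `Ξ_{K′}` and `g` of `Ξ_K`, the `Ξ_K`-coordinate of
`restrict [J, g′_q K′]` is `Index.restrict q` (which coarser piece the finer piece lands in). [cite: Milne2005ShimuraVarieties, Lemma 5.13 p. 57] -/
theorem equivSigma_restrict_fst (h : K' ≤ K) {g' : Index δ K' → gspFinAdelic δ} (hg' : ∀ q, indexOf δ K' (g' q) = q)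
    {g : Index δ K → gspFinAdelic δ} (hg : ∀ q, indexOf δ K (g q) = q) (c : SiegelShimuraSet δ K') :
    (equivSigma hg (restrict δ h c)).1 = Index.restrict δ h ((equivSigma hg' c).1) := by
  rw [equivSigma_fst, equivSigma_fst, index_restrict]

/-! ### §4. Principal levels `K_δ(N′) ≤ K_δ(N)`, `N ∣ N′` -/

/-- The transition map of the principal Siegel tower on complex points: `[J, aK_δ(N′)] ↦ [J, aK_δ(N)]` for `N ∣ N′` — the set-level
content of the record field `SiegelComplexRecordSystem.map_pts`. [cite: Deligne1971TravauxShimura, 1.8 p. 129 and 4.16 p. 150] -/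
theorem restrict_principalLevelSubgroup_mk {N N' : ℕ} (hNN' : N ∣ N') (J : C0pm δ) (a : gspFinAdelic δ) :
    restrict δ (principalLevelSubgroup_anti δ hNN') (SiegelShimuraSet.mk δ (principalLevelSubgroup δ N') J a) =
      SiegelShimuraSet.mk δ (principalLevelSubgroup δ N) J a :=
  rfl

/-- A complex record system's transition morphism along `K ≤ K′` acts on `[J, aK]` exactly as `restrict` (the field `map_pts`
rephrased with the set-level map). [cite: Deligne1971TravauxShimura, 1.8 p. 129] -/
theorem _root_.Literature.AlgebraicGeometry.ModuliOfAbelianVarieties.SiegelComplexRecordSystem.pts_map_eq_restrict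
    {δ : Fin g → ℕ} (S : SiegelComplexRecordSystem g δ) (K K' : SiegelLevel δ) (f : K ⟶ K') (c : SiegelShimuraSet δ K.1) :
    S.pts K' (AlgPoints.map (S.Mc.map f) ((S.pts K).symm c)) = restrict δ (SiegelLevel.le_of_hom f) c := by
  obtain ⟨⟨J, a⟩, rfl⟩ := SiegelShimuraSet.mk_surjective δ K.1 c
  exact S.map_pts K K' f J a

end SiegelShimuraSet

end Literature.AlgebraicGeometry.ModuliOfAbelianVarieties

end
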